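import Mathlib
import Summits.Ventures.PercRepro2.HCov
import Summits.Ventures.PercRepro2.EdgeCubic
import Summits.Ventures.PercRepro2.EdgeCubicAll
import Summits.Ventures.PercRepro2.CPolarA3
import Summits.Ventures.PercRepro2.CPolarA3Marks
import Summits.Ventures.PercRepro2.PendantA3Pins
import Summits.Ventures.PercRepro2.PendantClusterPins
import Summits.Ventures.PercRepro2.PendantClusterMasses
import Summits.Ventures.PercRepro2.CPolarA3Exists
import Summits.Ventures.PercRepro2.ClusterRootBern
import Summits.Ventures.PercRepro2.ReachRootEdge
import Summits.Ventures.PercRepro2.CPolarSub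
import Summits.Ventures.PercRepro2.CPolarSubPlus
import Summits.Ventures.PercRepro2.HCovPlusDiag
import Summits.Ventures.PercRepro2.CPolarSubNP
import Summits.Ventures.PercRepro2.InternalEdge
import Summits.Ventures.PercRepro2.QuarticPendant
import Summits.Ventures.PercRepro2.HCovPlusQuartic

/-!
# THE ROAD ON THE QUARTIC, PART I — where (HCOV⁺) is free, and the identified instance of a pendant
edge (blind cell PercRepro2, p5 g17; `proofs/P5-OEDGE.md` §23)

(HCOV⁺) holds for free wherever the cubic road has (HCOV) for free: a mark in the reach of `a₃`
(**`HCovPlus_of_mark_mem_pinnedReach`** — a root or `o` in the reach makes the form vanish or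
equal `Qo·D·slackB ≥ 0`; `b` in the reach is the diagonal theorem `hcovPlus_diag_b`), a null `Q`
(**`HCovPlus_of_Q_eq_zero`**), a reach with no fractional boundary edge
(**`HCovPlus_of_reach_pinned`**: `covU = 0` for an almost-surely inactive `a₃`), and an internal
fractional reach-edge (**`HCovPlus_of_internal`**: every mass is blind to it). The new fact for the
pendant face: the IDENTIFIED INSTANCE `(o, a₁, a₂, u, b)` of a pendant edge `f = {z, u}` of the
reach `K` does not see the pin of `f` — the five marks lie outside the blob `K`, so every mass of
(HCOV⁺) is `FreeAE` (`freeAE_avoid`, `freeAE_T`, `freeAE_PD`, the shapes `pz_*`) and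
**`hcovPlusVal_blob_eq`**: `hcovPlusVal p[f↦0] (o, a₁, a₂, u, b) = hcovPlusVal p (o, a₁, a₂, u, b)`.
This is what lets the joint induction of `QuarticRoad.lean` take (HCOV⁺) at the identified instance
from the induction hypothesis (one fractional edge fewer) instead of from a global `HCovPlus_all`.
-/

namespace Summit.Ventures.PercRepro2

open UnionCluster CovForm CovForm.CPolarA3 CovForm.EdgeLine PendantA3 PendantCluster CPolarA3Exists
  ClusterRoot ReachRoot CPolarSub CPolarSubPlus HCovPlusDiag CPolarSubNP InternalEdge
  QuarticPendant HCovPlusQuartic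

namespace QuarticRoadBase

/-! ## (HCOV⁺) where the cubic road has (HCOV) for free -/
section Base

variable {V : Type*} {E : Type*} [Fintype V] [DecidableEq V] [Fintype E] [DecidableEq E]
  {R : Type*} [Field R] [LinearOrder R] [IsStrictOrderedRing R]

variable {p : E → R} {ends : E → Sym2 V}

omit [Fintype V] [IsStrictOrderedRing R] in
/-- `covU = 0` for an almost-surely inactive `a₃` (`D = Q`, `Do = Qo`). -/
lemma covU_eq_zero_of_inactiveAE {o a₁ a₂ a₃ : V} (h : InactiveAE p ends a₁ a₂ a₃) :
    covU p ends o a₁ a₂ a₃ = 0 := by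
  rw [covU_eq]
  unfold Qo Do
  simp only [prob_PD_eq h, prob_PD_inter_eq h]
  ring

omit [Fintype V] [DecidableEq V] [IsStrictOrderedRing R] in
/-- `covU = 0` when `a₃` meets a root almost surely (`D = Do = 0`). -/
lemma covU_eq_zero_of_root {o a₁ a₂ a₃ : V}
    (h : ∀ ω : Config E, weight p ω ≠ 0 → Conn ends ω a₃ a₁ ∨ Conn ends ω a₃ a₂) :
    covU p ends o a₁ a₂ a₃ = 0 := by
  have hD : prob p (PDEvent ends a₁ a₂ a₃) = 0 := by
    have := prob_PD_inter_eq_zero_of_root h Set.univ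
    simpa only [Set.inter_univ] using this
  rw [covU_eq]
  unfold Do
  simp only [prob_PD_inter_eq_zero_of_root h, hD]
  ring

omit [Fintype V] [DecidableEq V] [IsStrictOrderedRing R] in
/-- (HCOV⁺) when `a₃` meets a root almost surely: the form vanishes. -/
theorem HCovPlus_of_root_joined {o a₁ a₂ a₃ b : V}
    (h : ∀ ω : Config E, weight p ω ≠ 0 → Conn ends ω a₃ a₁ ∨ Conn ends ω a₃ a₂) :
    HCovPlus p ends o a₁ a₂ a₃ b := by
  rw [HCovPlus_iff]
  unfold hcovPlusVal
  rw [Gc_eq_zero_of_root o b h, covU_eq_zero_of_root h]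
  simp

omit [Fintype V] [DecidableEq V] [IsStrictOrderedRing R] in
/-- `Do = 0` when `o` is almost surely joined to `a₃` (`o ∈ U` would put `a₃ ∈ U`). -/
lemma Do_eq_zero_of_o_joined {o a₁ a₂ a₃ : V} (hj : ∀ ω, weight p ω ≠ 0 → Conn ends ω a₃ o) :
    Do p ends o a₁ a₂ a₃ = 0 := by
  unfold Do
  have key : ∀ x : V, (x = a₁ ∨ x = a₂) →
      prob p (PDEvent ends a₁ a₂ a₃ ∩ connEvent ends x o) = 0 := by
    intro x hx
    refine prob_eq_zero_of_weight_eq_zero p _ fun ω hω => ?_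
    by_contra hw
    have h3x : Conn ends ω a₃ x := conn_trans (hj ω hw) (conn_symm hω.2)
    have hPD := hω.1
    simp only [PDEvent, Dtilde, Set.mem_inter_iff, Set.mem_compl_iff, mem_inU] at hPD
    rcases hx with rfl | rfl
    · exact hPD.2 (Or.inl h3x)
    · exact hPD.2 (Or.inr h3x)
  rw [key a₁ (Or.inl rfl), key a₂ (Or.inr rfl)]
  ring

/-- (HCOV⁺) when `o` is almost surely joined to `a₃`: `Gc = 0` and the form is `Qo·D·slackB ≥ 0`. -/
theorem HCovPlus_of_o_joined (hp : IsProbVec p) {o a₁ a₂ a₃ b : V}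
    (hj : ∀ ω, weight p ω ≠ 0 → Conn ends ω a₃ o) : HCovPlus p ends o a₁ a₂ a₃ b := by
  rw [HCovPlus_iff]
  unfold hcovPlusVal
  rw [Gc_eq_zero_of_o_joined hj, covU_eq, Do_eq_zero_of_o_joined hj]
  have hsl := slack_nonneg p hp ends a₁ a₂ a₃ b
  rw [slackB_eq]; unfold Qb
  refine add_nonneg (by simp) (mul_nonneg ?_ hsl)
  simp only [mul_zero, sub_zero]
  exact mul_nonneg (add_nonneg (prob_nonneg hp _) (prob_nonneg hp _)) (prob_nonneg hp _)

/-- (HCOV⁺) when `b` is almost surely joined to `a₃`: the diagonal theorem `hcovPlus_diag_b`. -/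
theorem HCovPlus_of_b_joined (hp : IsProbVec p) {o a₁ a₂ a₃ b : V}
    (hj : ∀ ω, weight p ω ≠ 0 → Conn ends ω a₃ b) : HCovPlus p ends o a₁ a₂ a₃ b := by
  have key : hcovPlusVal p ends o a₁ a₂ a₃ b = hcovPlusVal p ends o a₁ a₂ a₃ a₃ := by
    unfold hcovPlusVal covU slackB Gc DEF EQbo EQb3 EQb3o EQo EQ3 EQ3o PDb PDbo Do
    rw [gap_eq_Q, gap_eq_Q]
    simp only [prob_inter_conn_eq hj, prob_inter_inter_conn_eq hj]
  rw [HCovPlus_iff, key]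
  exact hcovPlus_diag_b p hp o a₁ a₂ a₃

/-- **(HCOV⁺) when a mark lies in the pinned-open reach of `a₃`.** -/
theorem HCovPlus_of_mark_mem_pinnedReach (hp : IsProbVec p) {o a₁ a₂ a₃ b : V}
    (h : a₁ ∈ pinnedReach p ends a₃ ∨ a₂ ∈ pinnedReach p ends a₃ ∨ o ∈ pinnedReach p ends a₃ ∨
      b ∈ pinnedReach p ends a₃) : HCovPlus p ends o a₁ a₂ a₃ b := by
  rcases h with h | h | h | h
  · exact HCovPlus_of_root_joined fun ω hw => Or.inl (conn_of_mem_pinnedReach hw h)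
  · exact HCovPlus_of_root_joined fun ω hw => Or.inr (conn_of_mem_pinnedReach hw h)
  · exact HCovPlus_of_o_joined hp fun ω hw => conn_of_mem_pinnedReach hw h
  · exact HCovPlus_of_b_joined hp fun ω hw => conn_of_mem_pinnedReach hw h

omit [Fintype V] [DecidableEq V] in
/-- (HCOV⁺) when `Q` is null (every mass vanishes). -/
theorem HCovPlus_of_Q_eq_zero (hp : IsProbVec p) {o a₁ a₂ a₃ b : V}
    (hQ : prob p (avoidAll ends a₂ {a₁}) = 0) : HCovPlus p ends o a₁ a₂ a₃ b := by
  rw [HCovPlus_iff]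
  unfold hcovPlusVal
  have hD : prob p (PDEvent ends a₁ a₂ a₃) = 0 :=
    prob_eq_zero_of_subset_Q hp hQ (PD_subset_Q a₁ a₂ a₃)
  rw [covU_eq, hQ, hD]
  simp

/-- **(HCOV⁺) when no fractional edge touches the pinned-open reach of `a₃`.** -/
theorem HCovPlus_of_reach_pinned (hp : IsProbVec p) (o a₁ a₂ a₃ b : V)
    (hfr : ∀ e ∈ fracEdges p, ¬ TouchesReach p ends a₃ e) : HCovPlus p ends o a₁ a₂ a₃ b := by
  by_cases hroot : a₁ ∈ pinnedReach p ends a₃ ∨ a₂ ∈ pinnedReach p ends a₃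
  · rcases hroot with h | h
    · exact HCovPlus_of_root_joined fun ω hw => Or.inl (conn_of_mem_pinnedReach hw h)
    · exact HCovPlus_of_root_joined fun ω hw => Or.inr (conn_of_mem_pinnedReach hw h)
  · rw [not_or] at hroot
    have hin : InactiveAE p ends a₁ a₂ a₃ := by
      intro ω hw
      exact ⟨fun h => hroot.1 (conn_mem_pinnedReach hfr hw (conn_symm h)),
        fun h => hroot.2 (conn_mem_pinnedReach hfr hw (conn_symm h))⟩
    rw [HCovPlus_iff]
    unfold hcovPlusVal
    rw [covU_eq_zero_of_inactiveAE hin, zero_mul, add_zero]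
    exact mul_nonneg (prob_nonneg hp _) (HCov_of_reach_pinned p hp ends o a₁ a₂ a₃ b hfr)

end Base

/-! ## An internal fractional reach-edge is free for (HCOV⁺) too -/
section Internal

variable {V : Type*} {E : Type*} [Fintype E] [DecidableEq E] {R : Type*} [Field R]
  [LinearOrder R]

variable {p : E → R} {ends : E → Sym2 V} {e : E} {a₃ u z : V}

/-- Every mass of (HCOV⁺) is blind to an internal fractional edge. -/
theorem hcovPlusVal_internal_eq (hu : u ∈ pinnedReach p ends a₃) (hz : z ∈ pinnedReach p ends a₃)
    (he : ends e = s(u, z)) (hf1 : p e ≠ 1) (o a₁ a₂ b : V) :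
    hcovPlusVal (Function.update p e 0) ends o a₁ a₂ a₃ b = hcovPlusVal p ends o a₁ a₂ a₃ b := by
  unfold hcovPlusVal covU slackB EQb3 EQ3 PDb Do gap
  rw [← Gc_internal_eq hu hz he hf1]
  simp only [prob_Q_c_zero hu hz he hf1, prob_PD_zero hu hz he hf1, prob_PD_c_zero hu hz he hf1,
    prob_T_c_zero hu hz he hf1, prob_T_zero hu hz he hf1, prob_c_zero hu hz he hf1,
    prob_Q_zero hu hz he hf1]

/-- **(HCOV⁺) at the closed pin of an internal fractional edge gives (HCOV⁺) at `p`.** -/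
theorem HCovPlus_of_internal (hu : u ∈ pinnedReach p ends a₃) (hz : z ∈ pinnedReach p ends a₃)
    (he : ends e = s(u, z)) (hf1 : p e ≠ 1) (o a₁ a₂ b : V)
    (h₀ : HCovPlus (Function.update p e 0) ends o a₁ a₂ a₃ b) : HCovPlus p ends o a₁ a₂ a₃ b := by
  rw [HCovPlus_iff] at h₀ ⊢
  rw [← hcovPlusVal_internal_eq hu hz he hf1 o a₁ a₂ b]
  exact h₀

end Internal

/-! ## The identified instance of a pendant edge does not see the pin -/
section Blob

variable {V : Type*} {E : Type*} [Fintype E] [DecidableEq E] {R : Type*} [Field R]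
  [LinearOrder R]

variable {p : E → R} {ends : E → Sym2 V} {f : E} {a₃ z u : V}

omit [LinearOrder R] in
/-- The mass of a free event is unchanged by the closed pin. -/
lemma prob_update_zero_of_freeAE {X : Set (Config E)} (hX : FreeAE p f X) :
    prob (Function.update p f 0) X = prob p X :=
  prob_update_zero_eq_of_conn fun ω hw => hX ω hw false

omit [LinearOrder R] in
/-- Free events are closed under complement. -/
lemma FreeAE.compl' {X : Set (Config E)} (hX : FreeAE p f X) : FreeAE p f Xᶜ :=
  fun ω hw c => by simp only [Set.mem_compl_iff, hX ω hw c]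

omit [LinearOrder R] in
/-- Free events are closed under union. -/
lemma FreeAE.union' {X Y : Set (Config E)} (hX : FreeAE p f X) (hY : FreeAE p f Y) :
    FreeAE p f (X ∪ Y) := fun ω hw c => or_congr (hX ω hw c) (hY ω hw c)

variable (hK : ∀ e ∈ fracEdges p, TouchesReach p ends a₃ e → e = f) (hf : ends f = s(z, u))
  (hz : z ∈ pinnedReach p ends a₃) (hu : u ∉ pinnedReach p ends a₃) (hf1 : p f ≠ 1)

include hK hf hz hu hf1

/-- `{s ↮ t}` is free for `s, t` outside the reach. -/
lemma freeAE_avoid {s t : V} (hs : s ∉ pinnedReach p ends a₃) (ht : t ∉ pinnedReach p ends a₃) :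
    FreeAE p f (avoidAll ends s {t}) := by
  intro ω hw c
  simp only [mem_avoidAll, Finset.mem_singleton, forall_eq]
  exact not_congr (conn_update_iff hK hf hz hu hf1 hw hs ht c)

/-- `T(s, t, w)` is free for `s, t, w` outside the reach. -/
lemma freeAE_T {s t w : V} (hs : s ∉ pinnedReach p ends a₃) (ht : t ∉ pinnedReach p ends a₃)
    (hw : w ∉ pinnedReach p ends a₃) : FreeAE p f (TEvent ends s t w) :=
  (FreeAE.compl' (freeAE_connEvent hK hf hz hu hf1 ht hs)).inter (freeAE_connEvent hK hf hz hu hf1 ht hw)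

/-- `PD(s, t, w)` is free for `s, t, w` outside the reach. -/
lemma freeAE_PD {s t w : V} (hs : s ∉ pinnedReach p ends a₃) (ht : t ∉ pinnedReach p ends a₃)
    (hw : w ∉ pinnedReach p ends a₃) : FreeAE p f (PDEvent ends s t w) :=
  (FreeAE.compl' (freeAE_connEvent hK hf hz hu hf1 hs ht)).inter
    (FreeAE.compl' (FreeAE.union' (freeAE_connEvent hK hf hz hu hf1 hw hs)
      (freeAE_connEvent hK hf hz hu hf1 hw ht)))

/-- `P(x ↔ y)` at the closed pin, `x, y` outside the reach. -/
lemma pz_c {x y : V} (hx : x ∉ pinnedReach p ends a₃) (hy : y ∉ pinnedReach p ends a₃) :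
    prob (Function.update p f 0) (connEvent ends x y) = prob p (connEvent ends x y) :=
  prob_update_zero_of_freeAE (freeAE_connEvent hK hf hz hu hf1 hx hy)

/-- `P(s ↮ t)` at the closed pin, `s, t` outside the reach. -/
lemma pz_Q {s t : V} (hs : s ∉ pinnedReach p ends a₃) (ht : t ∉ pinnedReach p ends a₃) :
    prob (Function.update p f 0) (avoidAll ends s {t}) = prob p (avoidAll ends s {t}) :=
  prob_update_zero_of_freeAE (freeAE_avoid hK hf hz hu hf1 hs ht)

/-- `P({s ↮ t} ∩ {x ↔ y})` at the closed pin. -/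
lemma pz_Q_c {s t x y : V} (hs : s ∉ pinnedReach p ends a₃) (ht : t ∉ pinnedReach p ends a₃)
    (hx : x ∉ pinnedReach p ends a₃) (hy : y ∉ pinnedReach p ends a₃) :
    prob (Function.update p f 0) (avoidAll ends s {t} ∩ connEvent ends x y) =
      prob p (avoidAll ends s {t} ∩ connEvent ends x y) :=
  prob_update_zero_of_freeAE
    ((freeAE_avoid hK hf hz hu hf1 hs ht).inter (freeAE_connEvent hK hf hz hu hf1 hx hy))

/-- `P({s ↮ t} ∩ {x ↔ y} ∩ {x′ ↔ y′})` at the closed pin. -/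
lemma pz_Q_cc {s t x y x' y' : V} (hs : s ∉ pinnedReach p ends a₃) (ht : t ∉ pinnedReach p ends a₃)
    (hx : x ∉ pinnedReach p ends a₃) (hy : y ∉ pinnedReach p ends a₃)
    (hx' : x' ∉ pinnedReach p ends a₃) (hy' : y' ∉ pinnedReach p ends a₃) :
    prob (Function.update p f 0) (avoidAll ends s {t} ∩ (connEvent ends x y ∩ connEvent ends x' y')) =
      prob p (avoidAll ends s {t} ∩ (connEvent ends x y ∩ connEvent ends x' y')) :=
  prob_update_zero_of_freeAE ((freeAE_avoid hK hf hz hu hf1 hs ht).inter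
    ((freeAE_connEvent hK hf hz hu hf1 hx hy).inter (freeAE_connEvent hK hf hz hu hf1 hx' hy')))

/-- `P(T(s, t, w))` at the closed pin. -/
lemma pz_T {s t w : V} (hs : s ∉ pinnedReach p ends a₃) (ht : t ∉ pinnedReach p ends a₃)
    (hw : w ∉ pinnedReach p ends a₃) :
    prob (Function.update p f 0) (TEvent ends s t w) = prob p (TEvent ends s t w) :=
  prob_update_zero_of_freeAE (freeAE_T hK hf hz hu hf1 hs ht hw)

/-- `P(T(s, t, w) ∩ {x ↔ y})` at the closed pin. -/
lemma pz_T_c {s t w x y : V} (hs : s ∉ pinnedReach p ends a₃) (ht : t ∉ pinnedReach p ends a₃)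
    (hw : w ∉ pinnedReach p ends a₃) (hx : x ∉ pinnedReach p ends a₃)
    (hy : y ∉ pinnedReach p ends a₃) :
    prob (Function.update p f 0) (TEvent ends s t w ∩ connEvent ends x y) =
      prob p (TEvent ends s t w ∩ connEvent ends x y) :=
  prob_update_zero_of_freeAE
    ((freeAE_T hK hf hz hu hf1 hs ht hw).inter (freeAE_connEvent hK hf hz hu hf1 hx hy))

/-- `P(T(s, t, w) ∩ {x ↔ y} ∩ {x′ ↔ y′})` at the closed pin. -/
lemma pz_T_cc {s t w x y x' y' : V} (hs : s ∉ pinnedReach p ends a₃)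
    (ht : t ∉ pinnedReach p ends a₃) (hw : w ∉ pinnedReach p ends a₃)
    (hx : x ∉ pinnedReach p ends a₃) (hy : y ∉ pinnedReach p ends a₃)
    (hx' : x' ∉ pinnedReach p ends a₃) (hy' : y' ∉ pinnedReach p ends a₃) :
    prob (Function.update p f 0) (TEvent ends s t w ∩ (connEvent ends x y ∩ connEvent ends x' y')) =
      prob p (TEvent ends s t w ∩ (connEvent ends x y ∩ connEvent ends x' y')) :=
  prob_update_zero_of_freeAE ((freeAE_T hK hf hz hu hf1 hs ht hw).inter
    ((freeAE_connEvent hK hf hz hu hf1 hx hy).inter (freeAE_connEvent hK hf hz hu hf1 hx' hy')))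

/-- `P(PD(s, t, w))` at the closed pin. -/
lemma pz_PD {s t w : V} (hs : s ∉ pinnedReach p ends a₃) (ht : t ∉ pinnedReach p ends a₃)
    (hw : w ∉ pinnedReach p ends a₃) :
    prob (Function.update p f 0) (PDEvent ends s t w) = prob p (PDEvent ends s t w) :=
  prob_update_zero_of_freeAE (freeAE_PD hK hf hz hu hf1 hs ht hw)

/-- `P(PD(s, t, w) ∩ {x ↔ y})` at the closed pin. -/
lemma pz_PD_c {s t w x y : V} (hs : s ∉ pinnedReach p ends a₃) (ht : t ∉ pinnedReach p ends a₃)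
    (hw : w ∉ pinnedReach p ends a₃) (hx : x ∉ pinnedReach p ends a₃)
    (hy : y ∉ pinnedReach p ends a₃) :
    prob (Function.update p f 0) (PDEvent ends s t w ∩ connEvent ends x y) =
      prob p (PDEvent ends s t w ∩ connEvent ends x y) :=
  prob_update_zero_of_freeAE
    ((freeAE_PD hK hf hz hu hf1 hs ht hw).inter (freeAE_connEvent hK hf hz hu hf1 hx hy))

/-- `P(PD(s, t, w) ∩ {x ↔ y} ∩ {x′ ↔ y′})` at the closed pin. -/
lemma pz_PD_cc {s t w x y x' y' : V} (hs : s ∉ pinnedReach p ends a₃)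
    (ht : t ∉ pinnedReach p ends a₃) (hw : w ∉ pinnedReach p ends a₃)
    (hx : x ∉ pinnedReach p ends a₃) (hy : y ∉ pinnedReach p ends a₃)
    (hx' : x' ∉ pinnedReach p ends a₃) (hy' : y' ∉ pinnedReach p ends a₃) :
    prob (Function.update p f 0) (PDEvent ends s t w ∩ (connEvent ends x y ∩ connEvent ends x' y')) =
      prob p (PDEvent ends s t w ∩ (connEvent ends x y ∩ connEvent ends x' y')) :=
  prob_update_zero_of_freeAE ((freeAE_PD hK hf hz hu hf1 hs ht hw).inter
    ((freeAE_connEvent hK hf hz hu hf1 hx hy).inter (freeAE_connEvent hK hf hz hu hf1 hx' hy')))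

/-- **The identified instance `(o, a₁, a₂, u, b)` of a pendant edge does not see its pin**: every
mass of (HCOV⁺) at `p[f↦0]` is the mass at `p` (the five marks lie outside the blob `K`). -/
theorem hcovPlusVal_blob_eq {o a₁ a₂ b : V} (h1 : a₁ ∉ pinnedReach p ends a₃)
    (h2 : a₂ ∉ pinnedReach p ends a₃) (ho : o ∉ pinnedReach p ends a₃)
    (hb : b ∉ pinnedReach p ends a₃) :
    hcovPlusVal (Function.update p f 0) ends o a₁ a₂ u b = hcovPlusVal p ends o a₁ a₂ u b := by
  unfold hcovPlusVal covU slackB Gc DEF EQbo EQb3 EQb3o EQo EQ3 EQ3o PDb PDbo Do gap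
  simp only [pz_Q hK hf hz hu hf1, pz_Q_c hK hf hz hu hf1, pz_Q_cc hK hf hz hu hf1,
    pz_T hK hf hz hu hf1, pz_T_c hK hf hz hu hf1, pz_T_cc hK hf hz hu hf1, pz_PD hK hf hz hu hf1,
    pz_PD_c hK hf hz hu hf1, pz_PD_cc hK hf hz hu hf1, pz_c hK hf hz hu hf1, h1, h2, ho, hb, hu,
    not_false_eq_true]

end Blob

end QuarticRoadBase

end Summit.Ventures.PercRepro2
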